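import Summits.HodgeConjecture.HodgeConjecture.Theorems.Ring2WeilCoverageQuarticNormObstruction
import Summits.HodgeConjecture.HodgeConjecture.Theorems.Ring2WeilCoverageSplitPrimeDescent
import Summits.HodgeConjecture.HodgeConjecture.Theorems.Ring2WeilCoverageSplitPrimePellSigns
import Literature.NumberTheory.QuadraticFields.IntegralBasisConjugation
import Literature.NumberTheory.QuadraticFields.SquareRootGenerator
import Mathlib.NumberTheory.NumberField.Norm
import Mathlib.Algebra.Squarefree.Basic
import HarnessLib

/-!
# Weil-type family coverage — relative norms of units are TOTALLY POSITIVE: every unit of a number field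
# `L ⊇ ℚ(√13, √(78 − 18√13))` has `N_{L/ℚ(√13)} ≫ 0`, and every unit of `L ⊇ ℚ(√2, √7)` has `N_{L/ℚ(√2)} ≫ 0`
# (the arithmetic input of the twisted obstruction at the census levels `39` and `56`, elementary)

research route conditional on HC_CM; not a corollary; Q11.4-sentence-2 already refuted in dim ≥ 3.

Ring 2, WEIL-TYPE FAMILY-COVERAGE CENSUS (`HOME/WEIL-FAMILY-COVERAGE.md` `## b01`, block b01.25 (A) «every unit of
`ℚ(ζ₃₉)⁺ / ℚ(ζ₅₆)⁺` has totally positive relative norm to `ℚ(√13) / ℚ(√2)` — PARI-certified full unit group» and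
b01.38 (E) ROUTE NOTE; owner ring2-b01), part 34 of the `Ring2WeilCoverage*` series — the FIELD-LEVEL form of parts
32/32b (`…SplitPrimeDescent`, `…SplitPrimePellSigns`), in the style of part 30 §4.  For a number field `L ∋ s, w`
with `s² = d`, `w² = β = b₁ + b₂s ∈ ℤ[s]`, `w ∉ ℚ(s)`, and a unit `x` of `𝓞 L`:

* §1 `exists_int_coords_two_mul` — integrality in a quadratic field `F = ℚ(θ)`, `θ² = d` SQUAREFREE: every
  `y ∈ 𝓞 F` has `2y = U + Vθ` with `U, V ∈ ℤ` (the lane's Bhargava basis `(1, τ)`, `τ = (ε + √d_F)/2`,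
  `Literature…IntegralBasisConjugation.TauData`, and `d_F = d·c²` with `c ∈ ℤ`, `NumberField.exists_discr_eq_mul_sq`);
  `coords_unique` (coordinates on `(1, θ)` are unique).
* §2 **`relNorm_coords`**: `y := N_{L/ℚ(s)}(x)` is a unit of `𝓞 ℚ(s)`, so `2y = U + Vs` with `U² − dV² = ±4`, and
  `y = a² − βc²` for the rational coordinates `a = a₁ + a₂s`, `c = c₁ + c₂s` of `N_{L/ℚ(s,w)}(x) = a + cw`
  (`N_{L/ℚ(s)} = N_{ℚ(s,w)/ℚ(s)} ∘ N_{L/ℚ(s,w)}`, part 30's `norm_quadratic`), whence the explicit rational formulae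
  for `U, V`; `re_embedding_pos_of_coords`: if moreover `U > 0` and `U² − dV² > 0` then `Re σ(y) > 0` for EVERY
  embedding `σ : L → ℂ` (`σ(s) = ±√d` is real).
* (§3 = the companion file `…RelativeNormPositivityLevels`: the two instances `(d, β) = (13, 78 − 18√13)` —
  `L ⊇` the real cyclic quartic field of conductor `39` in `ℚ(ζ₃₉)⁺` — and `(2, 7)` — `L ⊇ ℚ(√2, √7) ⊂ ℚ(ζ₅₆)⁺`:
  `Re σ(N_{L/ℚ(s)}(x)) > 0` for every unit `x` and every embedding `σ`.)

HONEST FRAMING: elementary algebraic number theory (norm forms of quadratic extensions, a descent in `ℤ[√d]`, two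
Pell equations); the statements are about units of number fields containing the displayed elements; nothing here
mentions Hodge classes, polarisations, `W_K` or HC; `HC_CM` is used nowhere.  No `def`, no named fact, no `sorry`.
Seat-derived [folklore]; the integral basis of a quadratic field is [cite: Cox2013, §7.A].
-/

noncomputable section

open Module NumberField IntermediateField

namespace Summit.HodgeConjecture.Ring2WeilCoverage.RelativeNormPositivity

open Summit.HodgeConjecture.Ring2WeilCoverage.QuarticNormObstruction (exists_coords norm_quadratic
  finrank_adjoin_eq_two)
open Summit.HodgeConjecture.Ring2WeilCoverage.SplitPrimeDescent (isSquare_lift_of_coords)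
open Summit.HodgeConjecture.Ring2WeilCoverage.SplitPrimePellSigns
open Literature.NumberTheory.QuadraticFields.Quadratic (TauData nonempty_tauData)

/-! ### §1 Integrality in a quadratic field `ℚ(θ)`, `θ² = d` squarefree: `2·𝓞 ⊆ ℤ + ℤθ` -/

/-- If `d` is squarefree and `d·q²` is an integer (`q ∈ ℚ`), then `q ∈ ℤ` (the denominator of `q` has its square
dividing `d`).
research route conditional on HC_CM; not a corollary; Q11.4-sentence-2 already refuted in dim ≥ 3. [folklore] -/
theorem exists_int_eq_of_squarefree_mul_sq {d n : ℤ} (hd : Squarefree d) {q : ℚ} (h : (n : ℚ) = d * q ^ 2) :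
    ∃ m : ℤ, (m : ℚ) = q := by
  have hq : q = q.num / q.den := (Rat.num_div_den q).symm
  have key : n * (q.den : ℤ) ^ 2 = d * q.num ^ 2 := by
    have e : ((n * (q.den : ℤ) ^ 2 : ℤ) : ℚ) = ((d * q.num ^ 2 : ℤ) : ℚ) := by
      push_cast
      rw [h, ← Rat.mul_den_eq_num q]
      ring
    exact_mod_cast e
  -- `den² ∣ d·num²`, `gcd(den, num) = 1` ⇒ `den² ∣ d` ⇒ `den` is a unit
  have hcop : IsCoprime ((q.den : ℤ) ^ 2) (q.num ^ 2) := by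
    have h1 : IsCoprime (q.num) (q.den : ℤ) := by
      rw [Int.isCoprime_iff_gcd_eq_one]
      exact_mod_cast q.reduced
    exact h1.symm.pow
  have hdvd : (q.den : ℤ) ^ 2 ∣ d := by
    have h1 : (q.den : ℤ) ^ 2 ∣ d * q.num ^ 2 := ⟨n, by linear_combination -key⟩
    exact hcop.dvd_of_dvd_mul_right h1
  have hunit : IsUnit (q.den : ℤ) := hd _ (by rw [← sq]; exact hdvd)
  have hden1 : q.den = 1 := by
    rcases Int.isUnit_iff.mp hunit with h1 | h1
    · exact_mod_cast h1
    · exfalso; have := q.den_nz; omega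
  refine ⟨q.num, ?_⟩
  rw [hq, hden1]; simp

/-- **Coordinates on `(1, θ)` are unique** (`θ ∉ ℚ`): `P + Qθ = P′ + Q′θ` with rational `P, Q, P′, Q′` forces
`P = P′`, `Q = Q′`.
research route conditional on HC_CM; not a corollary; Q11.4-sentence-2 already refuted in dim ≥ 3. [folklore] -/
theorem coords_unique {F : Type*} [Field F] [Algebra ℚ F] {θ : F} (hθ : θ ∉ Set.range (algebraMap ℚ F))
    {P Q P' Q' : ℚ} (h : algebraMap ℚ F P + algebraMap ℚ F Q * θ = algebraMap ℚ F P' + algebraMap ℚ F Q' * θ) :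
    P = P' ∧ Q = Q' := by
  have hQ : Q = Q' := by
    by_contra hne
    apply hθ
    have hne' : algebraMap ℚ F (Q - Q') ≠ 0 := by
      rw [map_ne_zero_iff _ (algebraMap ℚ F).injective]; exact sub_ne_zero.mpr hne
    refine ⟨(P' - P) / (Q - Q'), ?_⟩
    rw [map_div₀, div_eq_iff hne', map_sub, map_sub]
    linear_combination -h
  refine ⟨?_, hQ⟩
  rw [hQ] at h
  exact (algebraMap ℚ F).injective (by linear_combination h)

/-- **`2·𝓞_F ⊆ ℤ + ℤθ`** for a quadratic field `F ∋ θ ∉ ℚ`, `θ² = d` with `d` SQUAREFREE: every algebraic integer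
`y` of `F` has `2y = U + Vθ`, `U, V ∈ ℤ`.  (On the lane's basis `(1, τ)`, `τ = (ε + s_F)/2`, `s_F² = d_F = d·c²` with
`c ∈ ℚ`, in fact `c ∈ ℤ` as `d` is squarefree; `s_F = ±cθ`.)
research route conditional on HC_CM; not a corollary; Q11.4-sentence-2 already refuted in dim ≥ 3. [cite: Cox2013, §7.A] -/
theorem exists_int_coords_two_mul {F : Type*} [Field F] [NumberField F] (h2 : finrank ℚ F = 2) {θ : F} {d : ℤ}
    (hθ : θ ∉ Set.range (algebraMap ℚ F)) (hθ2 : θ ^ 2 = (d : F)) (hd : Squarefree d) (y : 𝓞 F) :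
    ∃ U V : ℤ, 2 * (y : F) = (U : F) + (V : F) * θ := by
  obtain ⟨T⟩ := nonempty_tauData h2
  obtain ⟨u, v, hy⟩ := T.exists_int_coords_coe y
  obtain ⟨c, -, hdisc⟩ := NumberField.exists_discr_eq_mul_sq h2 hθ (c := (d : ℚ)) (by rw [hθ2]; simp)
  obtain ⟨m, hm⟩ := exists_int_eq_of_squarefree_mul_sq hd hdisc
  have hs2 : ((T.s : 𝓞 F) : F) ^ 2 = ((m : F) * θ) ^ 2 := by
    rw [T.sq_s, mul_pow, hθ2]
    have e : ((NumberField.discr F : ℤ) : F) = ((NumberField.discr F : ℚ) : F) := by push_cast; rfl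
    rw [e, hdisc, ← hm]
    push_cast
    ring
  rcases sq_eq_sq_iff_eq_or_eq_neg.mp hs2 with h | h
  · refine ⟨2 * u + v * T.ε, v * m, ?_⟩
    rw [hy, h]; push_cast; ring
  · refine ⟨2 * u + v * T.ε, -(v * m), ?_⟩
    rw [hy, h]; push_cast; ring

/-! ### §2 The relative norm of a unit: integer coordinates `2N = U + Vs`, `U² − dV² = ±4`, and the rational formulae -/

/-- A complex number whose square is a positive real number is real, with real part squaring to that number.
research route conditional on HC_CM; not a corollary; Q11.4-sentence-2 already refuted in dim ≥ 3. [folklore] -/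
theorem im_eq_zero_of_sq_eq_pos {z : ℂ} {d : ℝ} (hd : 0 < d) (hz : z ^ 2 = (d : ℂ)) :
    z.im = 0 ∧ z.re ^ 2 = d := by
  have hre := congrArg Complex.re hz
  have him := congrArg Complex.im hz
  simp only [sq, Complex.mul_re, Complex.mul_im, Complex.ofReal_re, Complex.ofReal_im] at hre him
  have him0 : z.im = 0 := by
    by_contra h
    have hre0 : z.re = 0 := by
      have h2 : z.re * z.im = 0 := by linarith
      rcases mul_eq_zero.mp h2 with h3 | h3
      · exact h3
      · exact absurd h3 h
    rw [hre0] at hre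
    nlinarith [sq_nonneg z.im]
  refine ⟨him0, ?_⟩
  rw [him0] at hre
  nlinarith

/-- **Positivity at every embedding from the coordinates**: if `2y = U + Vs` in `L` with `s² = d > 0`, `U > 0` and
`U² − dV² > 0`, then `Re σ(y) > 0` for every `σ : L → ℂ` (`σ(s)` is a real square root of `d`; part 32b's
`pos_add_mul_of_norm_pos`).
research route conditional on HC_CM; not a corollary; Q11.4-sentence-2 already refuted in dim ≥ 3. [folklore] -/
theorem re_embedding_pos_of_coords {L : Type*} [Field L] {d : ℤ} (hd : 0 < d) {s y : L} (hs : s ^ 2 = (d : L))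
    {U V : ℤ} (hy : 2 * y = (U : L) + (V : L) * s) (hU : 0 < U) (hn : 0 < U ^ 2 - d * V ^ 2) (σ : L →+* ℂ) :
    0 < (σ y).re := by
  have hσs : (σ s) ^ 2 = ((d : ℝ) : ℂ) := by
    rw [← map_pow, hs, map_intCast]; norm_cast
  obtain ⟨him, hre⟩ := im_eq_zero_of_sq_eq_pos (by exact_mod_cast hd) hσs
  have h2 : 2 * (σ y).re = (U : ℝ) + V * (σ s).re := by
    have e := congrArg σ hy
    rw [map_mul, map_ofNat, map_add, map_mul, map_intCast, map_intCast] at e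
    have e' := congrArg Complex.re e
    simp only [Complex.mul_re, Complex.re_ofNat, Complex.im_ofNat, zero_mul, sub_zero, Complex.add_re,
      Complex.intCast_re, Complex.intCast_im, him, mul_zero] at e'
    linarith
  have hpos := pos_add_mul_of_norm_pos hU hn hre
  linarith

/-- **The relative norm of a unit in coordinates.**  `L` a number field, `s, w ∈ L`, `s² = d` (`d ∈ ℤ` squarefree,
not a square), `w² = b₁ + b₂s` (`bᵢ ∈ ℤ`), `w ∉ ℚ(s)`; `x` a unit of `𝓞 L`; `y := N_{L/ℚ(s)}(x)`.  Then there are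
rationals `a₁, a₂, c₁, c₂` and integers `U, V` with `2y = U + Vs`, `U² − dV² = ±4`, and
`U = 2(a₁² + da₂² − b₁P − db₂Q)`, `V = 2(2a₁a₂ − b₁Q − b₂P)` where `P = c₁² + dc₂²`, `Q = 2c₁c₂`
(`N_{L/ℚ(s,w)}(x) = a + cw`, `a = a₁ + a₂s`, `c = c₁ + c₂s`, `y = N_{ℚ(s,w)/ℚ(s)}(a + cw) = a² − (b₁ + b₂s)c²`; `y` is a
unit of `𝓞 ℚ(s)`, so `2y ∈ ℤ + ℤs` by §1 and `N_{ℚ(s)/ℚ}(y) = (U² − dV²)/4 = ±1`).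
research route conditional on HC_CM; not a corollary; Q11.4-sentence-2 already refuted in dim ≥ 3. [folklore] -/
theorem relNorm_coords {L : Type*} [Field L] [NumberField L] {d b₁ b₂ : ℤ} (hd : Squarefree d)
    (hdsq : ¬ IsSquare (d : ℚ)) {s w : L} (hs : s ^ 2 = (d : L)) (hw : w ^ 2 = (b₁ : L) + (b₂ : L) * s)
    (hws : w ∉ Set.range (algebraMap ℚ⟮s⟯ L)) (x : (𝓞 L)ˣ) :
    ∃ (a₁ a₂ c₁ c₂ : ℚ) (U V : ℤ),
      (U : ℚ) = 2 * (a₁ ^ 2 + d * a₂ ^ 2 - b₁ * (c₁ ^ 2 + d * c₂ ^ 2) - d * b₂ * (2 * c₁ * c₂)) ∧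
      (V : ℚ) = 2 * (2 * a₁ * a₂ - b₁ * (2 * c₁ * c₂) - b₂ * (c₁ ^ 2 + d * c₂ ^ 2)) ∧
      (U ^ 2 - d * V ^ 2 = 4 ∨ U ^ 2 - d * V ^ 2 = -4) ∧
      2 * algebraMap ℚ⟮s⟯ L (Algebra.norm ℚ⟮s⟯ ((x : 𝓞 L) : L)) = (U : L) + (V : L) * s := by
  classical
  have hsℚ : s ∉ Set.range (algebraMap ℚ L) := by
    rintro ⟨r, hr⟩
    apply hdsq
    have h1 : algebraMap ℚ L (r ^ 2) = algebraMap ℚ L (d : ℚ) := by rw [map_pow, hr, hs]; simp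
    exact ⟨r, by rw [← sq]; exact ((algebraMap ℚ L).injective h1).symm⟩
  have hint : IsIntegral ℚ s := Algebra.IsIntegral.isIntegral s
  have hss : s * s = algebraMap ℚ L (d : ℚ) := by rw [← sq, hs]; simp
  -- `F₁ = ℚ(s)`, a quadratic number field
  set F₁ : IntermediateField ℚ L := ℚ⟮s⟯ with hF₁
  haveI : NumberField F₁ := NumberField.mk
  haveI : FiniteDimensional F₁ L := Module.Finite.of_restrictScalars_finite ℚ F₁ L
  have h2 : finrank ℚ F₁ = 2 := finrank_adjoin_eq_two hint hss hsℚ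
  set s₁ : F₁ := AdjoinSimple.gen ℚ s with hs₁def
  have hs₁L : algebraMap F₁ L s₁ = s := AdjoinSimple.algebraMap_gen ℚ s
  have hs₁ : s₁ * s₁ = algebraMap ℚ F₁ (d : ℚ) := by
    apply (algebraMap F₁ L).injective
    rw [map_mul, hs₁L, ← IsScalarTower.algebraMap_apply ℚ F₁ L, hss]
  have hs₁' : s₁ ^ 2 = ((d : ℤ) : F₁) := by rw [sq, hs₁]; simp
  have hs₁ℚ : s₁ ∉ Set.range (algebraMap ℚ F₁) := by
    rintro ⟨r, hr⟩
    exact hsℚ ⟨r, by rw [IsScalarTower.algebraMap_apply ℚ F₁ L, hr, hs₁L]⟩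
  -- `β = b₁ + b₂ s ∈ F₁`
  set β₁ : F₁ := algebraMap ℚ F₁ (b₁ : ℚ) + algebraMap ℚ F₁ (b₂ : ℚ) * s₁ with hβ₁
  have hww : w * w = algebraMap F₁ L β₁ := by
    rw [hβ₁, map_add, map_mul, hs₁L, ← IsScalarTower.algebraMap_apply ℚ F₁ L,
      ← IsScalarTower.algebraMap_apply ℚ F₁ L, ← sq, hw]
    simp
  have hwF₁ : w ∉ Set.range (algebraMap F₁ L) := hws
  -- `F₂ = F₁(w)`
  have hintw : IsIntegral F₁ w := (Algebra.IsIntegral.isIntegral (R := ℚ) w).tower_top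
  set F₂ : IntermediateField F₁ L := F₁⟮w⟯ with hF₂
  have h2' : finrank F₁ F₂ = 2 := finrank_adjoin_eq_two hintw hww hwF₁
  set w₂ : F₂ := AdjoinSimple.gen F₁ w with hw₂def
  have hw₂L : algebraMap F₂ L w₂ = w := AdjoinSimple.algebraMap_gen F₁ w
  have hw₂ : w₂ * w₂ = algebraMap F₁ F₂ β₁ := by
    apply (algebraMap F₂ L).injective
    rw [map_mul, hw₂L, ← IsScalarTower.algebraMap_apply F₁ F₂ L, hww]
  have hw₂F : w₂ ∉ Set.range (algebraMap F₁ F₂) := by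
    rintro ⟨r, hr⟩
    exact hwF₁ ⟨r, by rw [IsScalarTower.algebraMap_apply F₁ F₂ L, hr, hw₂L]⟩
  -- the unit `y = N_{L/F₁}(x)` and its integer coordinates
  set y₀ : 𝓞 F₁ := RingOfIntegers.norm F₁ (x : 𝓞 L) with hy₀
  have hy₀u : IsUnit y₀ := (RingOfIntegers.isUnit_norm F₁).mpr x.isUnit
  have hy₀F : (y₀ : F₁) = Algebra.norm F₁ ((x : 𝓞 L) : L) := RingOfIntegers.coe_norm F₁ (x : 𝓞 L)
  obtain ⟨U, V, hUV⟩ := exists_int_coords_two_mul h2 hs₁ℚ hs₁' hd y₀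
  -- `N_{F₁/ℚ}(y) = ±1` ⇒ `U² − dV² = ±4`
  have hNy : Algebra.norm ℚ (y₀ : F₁) = 1 ∨ Algebra.norm ℚ (y₀ : F₁) = -1 := by
    have h1 : IsUnit (Algebra.norm ℤ y₀) := hy₀u.map _
    rcases Int.isUnit_iff.mp h1 with h | h
    · left; rw [← Algebra.coe_norm_int, h]; norm_num
    · right; rw [← Algebra.coe_norm_int, h]; norm_num
  have hycoord : (y₀ : F₁) = algebraMap ℚ F₁ (U / 2) + algebraMap ℚ F₁ (V / 2) * s₁ := by
    simp only [map_div₀, map_intCast, map_ofNat]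
    linear_combination hUV / 2
  have hNcoord : Algebra.norm ℚ (y₀ : F₁) = (U / 2) ^ 2 - d * (V / 2) ^ 2 := by
    rw [hycoord]; exact norm_quadratic h2 hs₁ hs₁ℚ _ _
  have hpm : U ^ 2 - d * V ^ 2 = 4 ∨ U ^ 2 - d * V ^ 2 = -4 := by
    rcases hNy with h | h
    · left
      have e : ((U ^ 2 - d * V ^ 2 : ℤ) : ℚ) = ((4 : ℤ) : ℚ) := by
        push_cast; rw [h] at hNcoord; linear_combination -4 * hNcoord
      exact_mod_cast e
    · right
      have e : ((U ^ 2 - d * V ^ 2 : ℤ) : ℚ) = ((-4 : ℤ) : ℚ) := by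
        push_cast; rw [h] at hNcoord; linear_combination -4 * hNcoord
      exact_mod_cast e
  -- rational coordinates of `N_{L/F₂}(x) = a + c w` and the resulting formula for `y`
  have hN : Algebra.norm F₁ (Algebra.norm F₂ ((x : 𝓞 L) : L)) = Algebra.norm F₁ ((x : 𝓞 L) : L) :=
    Algebra.norm_norm (R := F₁) (S := F₂) (A := L)
  obtain ⟨a, c, hac⟩ := exists_coords h2' hw₂F (Algebra.norm F₂ ((x : 𝓞 L) : L))
  obtain ⟨a₁, a₂, ha⟩ := exists_coords h2 hs₁ℚ a
  obtain ⟨c₁, c₂, hc⟩ := exists_coords h2 hs₁ℚ c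
  set Y₁ : ℚ := a₁ ^ 2 + d * a₂ ^ 2 - b₁ * (c₁ ^ 2 + d * c₂ ^ 2) - d * b₂ * (2 * c₁ * c₂) with hY₁
  set Y₂ : ℚ := 2 * a₁ * a₂ - b₁ * (2 * c₁ * c₂) - b₂ * (c₁ ^ 2 + d * c₂ ^ 2) with hY₂
  have hy : Algebra.norm F₁ ((x : 𝓞 L) : L) = algebraMap ℚ F₁ Y₁ + algebraMap ℚ F₁ Y₂ * s₁ := by
    rw [← hN, hac, norm_quadratic h2' hw₂ hw₂F a c, ha, hc, hβ₁, hY₁, hY₂]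
    simp only [map_add, map_sub, map_mul, map_pow, map_intCast, map_ofNat]
    linear_combination ((algebraMap ℚ F₁ a₂) ^ 2 - (b₁ : F₁) * (algebraMap ℚ F₁ c₂) ^ 2 -
      2 * (b₂ : F₁) * algebraMap ℚ F₁ c₁ * algebraMap ℚ F₁ c₂ -
      (b₂ : F₁) * (algebraMap ℚ F₁ c₂) ^ 2 * s₁) * hs₁'
  -- uniqueness of coordinates: `U = 2Y₁`, `V = 2Y₂`
  have huniq : U / 2 = Y₁ ∧ V / 2 = Y₂ := by
    apply coords_unique hs₁ℚ
    rw [← hycoord, hy₀F, hy]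
  refine ⟨a₁, a₂, c₁, c₂, U, V, ?_, ?_, hpm, ?_⟩
  · rw [hY₁] at huniq; linear_combination 2 * huniq.1
  · rw [hY₂] at huniq; linear_combination 2 * huniq.2
  · have e := congrArg (algebraMap F₁ L) hUV
    rw [map_mul, map_ofNat, map_add, map_mul, hs₁L, hy₀F] at e
    have e1 : algebraMap F₁ L (U : F₁) = (U : L) := map_intCast _ _
    have e2 : algebraMap F₁ L (V : F₁) = (V : L) := map_intCast _ _
    rw [e1, e2] at e
    exact e

end Summit.HodgeConjecture.Ring2WeilCoverage.RelativeNormPositivity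

end
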